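import Summits.BirchSwinnertonDyer.BirchSwinnertonDyer.Theorems.RamifiedHeegnerPairLeafRankOneUpperAtThreeTwoSplitReading
import HarnessLib

/-!
# Route `RamifiedHeegnerPair`, crux U₁ `LeafRankOneUpperAtThree` (stmt-BirchSwinnertonDyer-26022), line `splitkolyvagin` —
# the S2 EXIT, part 2: the route decl U₁ BY NAME ⟸ PUB⁺ (27491) ∧ THREE NAMED PRINT FACTS ∧ Σ★″ (27493) ∧ L₀ (26023);
# the reading-grade child S2 (27492) is NO LONGER an input of the U₁ family

HONEST FRAMING. Theorems only; helper file (`--supports stmt-BirchSwinnertonDyer-26022 --as helper`); nothing is booked,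
no item is closed, BSD is not proved for any curve; CONDITIONAL on every displayed input. Lead prover bsd-line-rhp-p2 g8,
2026-08-28. Sibling of `…LeafRankOneUpperAtThreeTwoSplitReading.lean` (§1 Σ-callback told that `2` splits, §2 U₁ on a
mono-carrier row from the 2-SPLIT reading S2|₂, §3 S2|₂ ⟸ {Gross 1991 Prop. 3.7 (2), Poitou–Tate duality for Selmer structures,
[GZ86 III (3.1)] image-free} — `bsd-potss` k9-c4 g11's swap node BY NAME), which this file threads through the optimal member:

* §4 `leafRankOneUpper_three_of_latticeOptimal_of_twoSplitReading_of_sigmaOptOffRows_of_lowerRankZero` — p621612's §4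
  (`…_of_latticeOptimal_of_divisibilityReading_…`) with S2 replaced by S2|₂; the off-row branch is unchanged (Σ″ at the datum).
* §5 `leafRankOneUpperAtThree_of_pubManin_of_twoSplitReading_of_sigmaOptOffRows_of_lowerRankZero` — p622097's §5 with S2
  replaced by S2|₂: the route decl BY NAME from PUB⁺ (item 27491 BY NAME) ∧ S2|₂ ∧ Σ″ ∧ L₀ (optimal member + Cassels/GZK
  transport, byte-parallel).
* §6 **`leafRankOneUpperAtThree_of_pubManin_of_namedFacts_of_sigmaStarOptOffRows_of_lowerRankZero`** — the HEADLINE: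
  `LeafRankOnePrintedInputsAtThree → prop37_2_frobeniusCongruence → (∀ K, poitouTate_selmerStructure_duality_conj K) →
  Gross1991_heegnerPoint_sub_ratTorsion_mem_E0_imageFree → LeafSigmaStarDivisibilityAtThreeOptimalOffRows →
  Gss2LowerAtThreeRankZero → LeafRankOneUpperAtThree` — every hypothesis a route decl or a Literature named fact BY NAME;
  and `leafRankOneUpperAtThreeGlue_of_namedFacts_of_lowerRankZero` — the glue item 27494's statement with its S2 argument IDLE.

NET for the planner (no route edit performed or asked here): modulo print + the three named facts, **U₁ ⟸ Σ★″ ∧ L₀** (and, with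
rhp-p2 g7's roads, ⟸ Σ★″ ∧ (L₀ | TU₁ | PL₀)); the child 27492 keeps, AS TYPED (all `K`), only the corner «`p = 3`, `a₂ = 0`,
`2` inert in `K`, `ρ̄₃` irreducible non-surjective» which no composition of this route visits. BSD is not proved; U₁ is OPEN
(Σ★″ = Jetchev's Σ-form at the additive `3`, research; L₀ residual).
References: [cite: Jetchev2008, Conj. 1.3, Thm. 1.4, Cor. 1.5 (p. 812)] [cite: GrossLMS1991, Prop. 3.7 (2) (p. 240), §6 p. 245]
[cite: GrossZagier1986, III (3.1); Thm. I.(6.3) and (7.3)] [cite: MilneADT2006, Ch. I, Thm. 4.10(b)] [cite: MatarNekovar2019,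
Thm. 0.7 (p. 456)] [cite: Mazur1978, Cor. 4.1] [cite: AbbesUllmo1996, Thm. A] [cite: Cesnavicius2018, Thm. 1.2]
[cite: Cassels1965ArithmeticVIII] [cite: MilneADT2006, Thm. I.7.3] [cite: FriedbergHoffstein1995, Thm. B] [cite: Miller2011LMS, Def. 1.1].
-/

-- D-0017: single-problem summit, so `Summit.BirchSwinnertonDyer.BirchSwinnertonDyer.…` repeats a namespace BY DESIGN.
set_option linter.dupNamespace false
set_option autoImplicit false

noncomputable section

open scoped Classical NumberField

open WeierstrassCurve IsDedekindDomain IsDedekindDomain.HeightOneSpectrum NumberField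
  Rat.HeightOneSpectrum Literature Literature.NumberTheory.EllipticCurves
  Literature.NumberTheory.EllipticCurves.ModularForms
  Literature.NumberTheory.EllipticCurves.Rank1Residual
  Literature.NumberTheory.EllipticCurves.Rank1Residual.Typed
  Literature.NumberTheory.QuadraticFields
  Summit.BirchSwinnertonDyer.Rank1Residual
  Summit.BirchSwinnertonDyer.Rank1Residual.Additive
  Summit.BirchSwinnertonDyer.Rank1Residual.X11b.Three
  Summit.BirchSwinnertonDyer.BirchSwinnertonDyer.Theses.RamifiedHeegnerPair
  Summit.BirchSwinnertonDyer.BirchSwinnertonDyer.Theorems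

namespace Summit.BirchSwinnertonDyer.BirchSwinnertonDyer.Theorems.RamifiedPairUpperBound

/-! ## §4 U₁ at a leaf curve carrying a lattice-optimal datum ⟸ print + S2|₂ + Σ″ + L₀ -/

/-- **U₁ AT A LEAF CURVE CARRYING A LATTICE-OPTIMAL DATUM, from print + S2|₂ + Σ″ + L₀** — p621612 §4
(`leafRankOneUpper_three_of_latticeOptimal_of_divisibilityReading_of_sigmaOptOffRows_of_lowerRankZero`) with the reading S2
replaced by the 2-SPLIT reading S2|₂ (`hD₂`: one extra binder «`SatisfiesHeegnerHypothesis 2 K`»). Case split on the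
Manin-free mono-multiplicative-carrier row predicate: ON the row, the sibling's §2 with the datum `Dt` itself (`3 ∤ c(Dt)`
by `not_three_dvd_c_of_latticeOptimal_of_subGss`); OFF the row, p610955's `leafRankOneUpper_three_of_sigmaAtDatum_of_lowerRankZero`
with Σ″ at `Dt` (unchanged). CONDITIONAL on every displayed input; nothing asserted about any curve.
[cite: Jetchev2008, Thm. 1.4 and Cor. 1.5 (p. 812)] [cite: MatarNekovar2019, Thm. 0.7 (p. 456)] [cite: Mazur1978, Cor. 4.1]
[cite: Stevens1989, Lemmas (5.2), (5.4)] [cite: FriedbergHoffstein1995, Thm. B] [cite: GrossZagier1986, Thm. I.(6.3) and (7.3)]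
[cite: Miller2011LMS, Def. 1.1] -/
theorem leafRankOneUpper_three_of_latticeOptimal_of_twoSplitReading_of_sigmaOptOffRows_of_lowerRankZero
    (hGZ : ∀ (N : ℕ) [NeZero N] (W : WeierstrassCurve ℚ) (K : Type) [Field K] [NumberField K],
      gross_zagier N W K)
    (hKo : ∀ (N : ℕ) [NeZero N] (W : WeierstrassCurve ℚ) (K : Type) [Field K] [NumberField K],
      kolyvagin N W K)
    (hGZK : rank_eq_analyticRank_of_analyticRank_le_one) (hmod : hasEntireLFunction_rat)
    (hGZ73 : GrossZagier1986_thm_I_7_3)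
    (hMN : MatarNekovar2019.thm07_padicValNat_card_sha_primary_add_le_of_globalDivisibility_of_irreducible)
    (hnf : exists_isNewformOf) (hFH : friedbergHoffstein_exists_heegnerField_splitDivisors_twist_ne_zero)
    (hM : mazur_not_dvd_maninConstant_of_odd) (hAU : abbesUllmo_not_dvd_maninConstant_of_not_dvd_level)
    (hC2 : cesnavicius_not_two_dvd_maninConstant_of_two_dvd_level)
    (hD₂ : ∀ (W : WeierstrassCurve ℚ) [W.IsElliptic] [W.IsGloballyMinimal] [NeZero (W.conductorNorm ℤ)],
      ¬ W.HasCM →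
      ∀ (K : Type) [Field K] [NumberField K], IsImaginaryQuadratic K →
      NumberField.discr K ≠ -3 → NumberField.discr K ≠ -4 →
      SatisfiesHeegnerHypothesis (W.conductorNorm ℤ) K → SatisfiesHeegnerHypothesis 2 K →
      ∀ (p : ℕ) [Fact p.Prime], p ≠ 2 → Addv W p → 0 ≤ padicValRat p W.j →
      W.HasIrreducibleModPGaloisRep p →
      ¬ p ∣ (W.baseChange ℚ_[p]).localTamagawaNumber ℤ_[p] →
      (∀ (q' : ℕ) [Fact q'.Prime], q' ∣ W.conductorNorm ℤ →
        p ∣ (W.baseChange ℚ_[q']).localTamagawaNumber ℤ_[q'] → ¬ q' ^ 2 ∣ W.conductorNorm ℤ) →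
      ∀ (Dt : ModularParametrizationData W (W.conductorNorm ℤ)) (β : ℤ) (ι : K →+* ℂ)
        (d₁ : KolyvaginHeegnerData Dt β ι 1), ¬ IsOfFinAddOrder d₁.derivedPoint →
      ∀ (q : ℕ) [Fact q.Prime], q ∣ W.conductorNorm ℤ → ¬ q ^ 2 ∣ W.conductorNorm ℤ → q ≠ p →
      ∀ (s : ℕ), s ≤ padicValNat p ((W.baseChange ℚ_[q]).localTamagawaNumber ℤ_[q]) →
      ∀ (n : ℕ) (d : KolyvaginHeegnerData Dt β ι n), Squarefree n →
        (∀ ℓ ∈ n.primeFactors, Zhang2014.IsKolyvaginPrime (W.conductorNorm ℤ) W K p ℓ ∧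
          s ≤ Zhang2014.kolyvaginIndex W p ℓ) →
        ∃ Q : (W.baseChange (ringClassField K ι n)).toAffine.Point,
          ((p ^ s : ℕ) : ℤ) • Q = d.derivedPoint)
    (hSig : ∀ (W : WeierstrassCurve ℚ) [W.IsElliptic] [W.IsGloballyMinimal] (N : ℕ) [NeZero N]
      (K : Type) [Field K] [NumberField K]
      (Dt : ModularParametrizationData W N) (H : HeegnerDatum N (NumberField.discr K)) (ι : K →+* ℂ)
      (P : (W.baseChange K).toAffine.Point),
      ¬ W.HasCM → Addv W 3 → SubGss W 3 → W.analyticRank = 1 → W.conductorNorm ℤ = N →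
      (∀ z ∈ Dt.L.lattice, ∃ w ∈ periodLattice Dt.f, z = Dt.c * w) →
      ¬ ((∃ (q : ℕ) (_ : Fact q.Prime), q ∣ N ∧ ¬ q ^ 2 ∣ N ∧
          padicValNat 3 W.tamagawaProduct ≤ padicValNat 3 ((W.baseChange ℚ_[q]).localTamagawaNumber ℤ_[q])) ∧
        (∀ (q' : ℕ) [Fact q'.Prime], q' ∣ N →
          3 ∣ (W.baseChange ℚ_[q']).localTamagawaNumber ℤ_[q'] → ¬ q' ^ 2 ∣ N)) →
      IsImaginaryQuadratic K → SatisfiesHeegnerHypothesis N K →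
      (W.quadraticTwist (NumberField.discr K : ℚ)).entireLFunction 1 ≠ 0 →
      (WeierstrassCurve.Affine.Point.map ι.toRatAlgHom) P = heegnerPointComplex Dt H →
      ¬ IsOfFinAddOrder P → Odd (NumberField.discr K) →
      ∀ (s' : ℕ), s' ≤ padicValNat 3 W.tamagawaProduct + padicValNat 3 Dt.c.natAbs →
      ∀ (n : ℕ) (d : KolyvaginHeegnerData Dt H.β ι n), Squarefree n →
      (∀ ℓ ∈ n.primeFactors, Zhang2014.IsKolyvaginPrime N W K 3 ℓ ∧ s' ≤ Zhang2014.kolyvaginIndex W 3 ℓ) →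
      Koly.PDiv d 3 s')
    (hL0 : Gss2LowerAtThreeRankZero)
    (W : WeierstrassCurve ℚ) [W.IsElliptic] [W.IsGloballyMinimal] [NeZero (W.conductorNorm ℤ)]
    (hCM : ¬ W.HasCM) (hadd : Addv W 3) (hsub : SubGss W 3) (hr : W.analyticRank = 1)
    (Dt : ModularParametrizationData W (W.conductorNorm ℤ))
    (hopt : ∀ z ∈ Dt.L.lattice, ∃ w ∈ periodLattice Dt.f, z = Dt.c * w) :
    MissingUpperBoundAt W 3 := by
  by_cases hrow : ((∃ (q : ℕ) (_ : Fact q.Prime), q ∣ W.conductorNorm ℤ ∧ ¬ q ^ 2 ∣ W.conductorNorm ℤ ∧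
          padicValNat 3 W.tamagawaProduct ≤ padicValNat 3 ((W.baseChange ℚ_[q]).localTamagawaNumber ℤ_[q])) ∧
        (∀ (q' : ℕ) [Fact q'.Prime], q' ∣ W.conductorNorm ℤ →
          3 ∣ (W.baseChange ℚ_[q']).localTamagawaNumber ℤ_[q'] → ¬ q' ^ 2 ∣ W.conductorNorm ℤ))
  · obtain ⟨⟨q, _, hqN, hq2, hmono⟩, htam⟩ := hrow
    exact leafRankOneUpper_three_monoCarrier_of_twoSplitReading_of_lowerRankZero hGZ hKo hGZK hmod hGZ73 hMN hnf
      hFH hD₂ hL0 W hCM hadd hsub hr q hqN hq2 hmono htam Dt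
      (not_three_dvd_c_of_latticeOptimal_of_subGss hM hAU hC2 hnf W Dt hopt hadd hsub)
  · exact leafRankOneUpper_three_of_sigmaAtDatum_of_lowerRankZero hGZ hKo hGZK hmod hGZ73 hMN hnf hFH hL0 W hCM hadd
      hsub hr Dt (fun K _ _ H ι P hK hHN hLt hP hnt hodd s' hs' n d hn hℓ ↦
        hSig W (W.conductorNorm ℤ) K Dt H ι P hCM hadd hsub hr rfl hopt hrow hK hHN hLt hP hnt hodd s' hs' n d hn hℓ)

/-! ## §5 The route decl from PUB⁺ (by name) + S2|₂ + Σ″ + L₀, via the optimal member -/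

/-- **`LeafRankOneUpperAtThree` ⟸ PUB⁺ + S2|₂ + Σ″ + L₀** (conclusion literally the route decl) — p622097 §5 with the
reading S2 replaced by the 2-SPLIT reading S2|₂. PUB⁺ = route item 27491 `LeafRankOnePrintedInputsAtThree` BY NAME (the
thirteen printed named facts); Σ″ = the research residue at lattice-optimal members off the mono-carrier rows; L₀ = item 26023
BY NAME. Proof byte-parallel: optimal member `W₀ ∼ W` (`exists_optimal_leaf_member`, modularity), §4 at `W₀`, transport back
(Cassels + GZK). CONDITIONAL on every displayed input; U₁ stays OPEN; BSD is not proved.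
[cite: Jetchev2008, Conj. 1.3, Thm. 1.4 (p. 812)] [cite: MatarNekovar2019, Thm. 0.7 (p. 456)] [cite: Mazur1978, Cor. 4.1]
[cite: MilneADT2006, Thm. I.7.3] [cite: EdixhovenManin1991, §1 and Prop. 2] [cite: FriedbergHoffstein1995, Thm. B]
[cite: GrossZagier1986, Thm. I.(6.3) and (7.3)] [cite: Miller2011LMS, Def. 1.1] -/
theorem leafRankOneUpperAtThree_of_pubManin_of_twoSplitReading_of_sigmaOptOffRows_of_lowerRankZero
    (hpub : LeafRankOnePrintedInputsAtThree)
    (hD₂ : ∀ (W : WeierstrassCurve ℚ) [W.IsElliptic] [W.IsGloballyMinimal] [NeZero (W.conductorNorm ℤ)],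
      ¬ W.HasCM →
      ∀ (K : Type) [Field K] [NumberField K], IsImaginaryQuadratic K →
      NumberField.discr K ≠ -3 → NumberField.discr K ≠ -4 →
      SatisfiesHeegnerHypothesis (W.conductorNorm ℤ) K → SatisfiesHeegnerHypothesis 2 K →
      ∀ (p : ℕ) [Fact p.Prime], p ≠ 2 → Addv W p → 0 ≤ padicValRat p W.j →
      W.HasIrreducibleModPGaloisRep p →
      ¬ p ∣ (W.baseChange ℚ_[p]).localTamagawaNumber ℤ_[p] →
      (∀ (q' : ℕ) [Fact q'.Prime], q' ∣ W.conductorNorm ℤ →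
        p ∣ (W.baseChange ℚ_[q']).localTamagawaNumber ℤ_[q'] → ¬ q' ^ 2 ∣ W.conductorNorm ℤ) →
      ∀ (Dt : ModularParametrizationData W (W.conductorNorm ℤ)) (β : ℤ) (ι : K →+* ℂ)
        (d₁ : KolyvaginHeegnerData Dt β ι 1), ¬ IsOfFinAddOrder d₁.derivedPoint →
      ∀ (q : ℕ) [Fact q.Prime], q ∣ W.conductorNorm ℤ → ¬ q ^ 2 ∣ W.conductorNorm ℤ → q ≠ p →
      ∀ (s : ℕ), s ≤ padicValNat p ((W.baseChange ℚ_[q]).localTamagawaNumber ℤ_[q]) →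
      ∀ (n : ℕ) (d : KolyvaginHeegnerData Dt β ι n), Squarefree n →
        (∀ ℓ ∈ n.primeFactors, Zhang2014.IsKolyvaginPrime (W.conductorNorm ℤ) W K p ℓ ∧
          s ≤ Zhang2014.kolyvaginIndex W p ℓ) →
        ∃ Q : (W.baseChange (ringClassField K ι n)).toAffine.Point,
          ((p ^ s : ℕ) : ℤ) • Q = d.derivedPoint)
    (hSig : ∀ (W : WeierstrassCurve ℚ) [W.IsElliptic] [W.IsGloballyMinimal] (N : ℕ) [NeZero N]
      (K : Type) [Field K] [NumberField K]
      (Dt : ModularParametrizationData W N) (H : HeegnerDatum N (NumberField.discr K)) (ι : K →+* ℂ)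
      (P : (W.baseChange K).toAffine.Point),
      ¬ W.HasCM → Addv W 3 → SubGss W 3 → W.analyticRank = 1 → W.conductorNorm ℤ = N →
      (∀ z ∈ Dt.L.lattice, ∃ w ∈ periodLattice Dt.f, z = Dt.c * w) →
      ¬ ((∃ (q : ℕ) (_ : Fact q.Prime), q ∣ N ∧ ¬ q ^ 2 ∣ N ∧
          padicValNat 3 W.tamagawaProduct ≤ padicValNat 3 ((W.baseChange ℚ_[q]).localTamagawaNumber ℤ_[q])) ∧
        (∀ (q' : ℕ) [Fact q'.Prime], q' ∣ N →
          3 ∣ (W.baseChange ℚ_[q']).localTamagawaNumber ℤ_[q'] → ¬ q' ^ 2 ∣ N)) →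
      IsImaginaryQuadratic K → SatisfiesHeegnerHypothesis N K →
      (W.quadraticTwist (NumberField.discr K : ℚ)).entireLFunction 1 ≠ 0 →
      (WeierstrassCurve.Affine.Point.map ι.toRatAlgHom) P = heegnerPointComplex Dt H →
      ¬ IsOfFinAddOrder P → Odd (NumberField.discr K) →
      ∀ (s' : ℕ), s' ≤ padicValNat 3 W.tamagawaProduct + padicValNat 3 Dt.c.natAbs →
      ∀ (n : ℕ) (d : KolyvaginHeegnerData Dt H.β ι n), Squarefree n →
      (∀ ℓ ∈ n.primeFactors, Zhang2014.IsKolyvaginPrime N W K 3 ℓ ∧ s' ≤ Zhang2014.kolyvaginIndex W 3 ℓ) →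
      Koly.PDiv d 3 s')
    (hL0 : Gss2LowerAtThreeRankZero) :
    LeafRankOneUpperAtThree := by
  intro W _ _ hCM hadd hsub hr
  obtain ⟨hGZ, hKo, hGZK, hmod, hGZ73, hMN, hnf, hFH, -, hCassels, hM, hAU, hC2⟩ := hpub
  haveI : Fact (Nat.Prime 3) := ⟨Nat.prime_three⟩
  obtain ⟨W₀, hW₀, hW₀', N, hN0, D₀, hiso, hN₀, -, hopt, hCM₀, hadd₀, hsub₀, hr₀⟩ :=
    exists_optimal_leaf_member hnf W hCM hadd hsub
  haveI := hW₀
  haveI := hW₀'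
  haveI := hN0
  -- settle U₁ at the optimal member `W₀`
  have h₀ : MissingUpperBoundAt W₀ 3 := by
    subst hN₀
    exact leafRankOneUpper_three_of_latticeOptimal_of_twoSplitReading_of_sigmaOptOffRows_of_lowerRankZero hGZ hKo hGZK
      hmod hGZ73 hMN hnf hFH hM hAU hC2 hD₂ hSig hL0 W₀ hCM₀ hadd₀ hsub₀ (hr₀.trans hr) D₀ hopt
  -- and transport it back along `W ∼ W₀`
  exact missingUpperBoundAt_of_isIsogenous_of_analyticRank_le_one hCassels hGZK hmod (le_of_eq hr) hiso h₀

/-! ## §6 HEADLINE: the route decl U₁ from PUB⁺ ∧ three named print facts ∧ Σ★″ ∧ L₀ — all BY NAME, no S2 -/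

/-- **`LeafRankOneUpperAtThree` (26022) ⟸ `LeafRankOnePrintedInputsAtThree` (27491) ∧ {Gross 1991 Prop. 3.7 (2), Poitou–Tate
duality for Selmer structures (∀ K), [GZ86 III (3.1)] image-free} ∧ `LeafSigmaStarDivisibilityAtThreeOptimalOffRows` (27493) ∧
`Gss2LowerAtThreeRankZero` (26023)** — every hypothesis a route decl or a Literature named fact BY NAME; the reading-grade
child `JetchevDivisibilityReadingS2` (27492) does NOT occur. = §5 ∘ {the sibling's `twoSplitReading_of_namedFacts`,
`sigmaOptOffRows_of_sigmaStarOptOffRows`}. CONDITIONAL on the displayed named facts (the three are PUBLISHED results typed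
as `def … : Prop`), on Σ★″ (research) and on L₀ (residual); nothing asserted about any curve; U₁ stays OPEN; BSD is not proved.
[cite: Jetchev2008, Thm. 1.4, Cor. 1.5, Conj. 1.3 (p. 812)] [cite: GrossLMS1991, Prop. 3.7 (2) (p. 240), §6 p. 245]
[cite: MilneADT2006, Ch. I, Thm. 4.10(b)] [cite: GrossZagier1986, III (3.1)] [cite: MatarNekovar2019, Thm. 0.7 (p. 456)]
[cite: FriedbergHoffstein1995, Thm. B] [cite: Mazur1978, Cor. 4.1] [cite: Miller2011LMS, Def. 1.1] -/
theorem leafRankOneUpperAtThree_of_pubManin_of_namedFacts_of_sigmaStarOptOffRows_of_lowerRankZero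
    (hpub : LeafRankOnePrintedInputsAtThree)
    (h37 : GrossLMS1991.prop37_2_frobeniusCongruence)
    (hPT : ∀ (K : Type) [Field K] [NumberField K],
      Literature.NumberTheory.GaloisCohomology.poitouTate_selmerStructure_duality_conj K)
    (hF1 : Gross1991_heegnerPoint_sub_ratTorsion_mem_E0_imageFree)
    (hStar : LeafSigmaStarDivisibilityAtThreeOptimalOffRows)
    (hL0 : Gss2LowerAtThreeRankZero) :
    LeafRankOneUpperAtThree :=
  leafRankOneUpperAtThree_of_pubManin_of_twoSplitReading_of_sigmaOptOffRows_of_lowerRankZero hpub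
    (twoSplitReading_of_namedFacts h37 hPT hF1) (sigmaOptOffRows_of_sigmaStarOptOffRows hStar) hL0

/-- **The glue item 27494's statement with its S2 argument IDLE**: `Gss2LowerAtThreeRankZero` ∧ the three named facts ⟹
`LeafRankOneUpperAtThreeGlue` (:= PUB⁺ → S2 → Σ★″ → U₁), the S2 hypothesis being discarded. Compare p626516's
`leafRankOneUpperAtThreeGlue_of_lowerRankZero` (which USES S2). CONDITIONAL; nothing asserted; BSD is not proved.
[cite: Jetchev2008, Thm. 1.4 (p. 812)] [cite: GrossLMS1991, Prop. 3.7 (2)] [cite: MilneADT2006, Ch. I, Thm. 4.10(b)] -/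
theorem leafRankOneUpperAtThreeGlue_of_namedFacts_of_lowerRankZero
    (h37 : GrossLMS1991.prop37_2_frobeniusCongruence)
    (hPT : ∀ (K : Type) [Field K] [NumberField K],
      Literature.NumberTheory.GaloisCohomology.poitouTate_selmerStructure_duality_conj K)
    (hF1 : Gross1991_heegnerPoint_sub_ratTorsion_mem_E0_imageFree)
    (hL0 : Gss2LowerAtThreeRankZero) :
    LeafRankOneUpperAtThreeGlue :=
  fun hpub _ hStar ↦
    leafRankOneUpperAtThree_of_pubManin_of_namedFacts_of_sigmaStarOptOffRows_of_lowerRankZero hpub h37 hPT hF1 hStar hL0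

end Summit.BirchSwinnertonDyer.BirchSwinnertonDyer.Theorems.RamifiedPairUpperBound

end
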